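import Literature.NumberTheory.GaloisRepresentations.LocalTowerCdOne
import Mathlib.NumberTheory.Padics.RingHoms
import HarnessLib

/-!
# `cd_p(Gal(F̄/F_∞)) ≤ 1` for the `ℤ_p`-tower of a local field (Serre, *Cohomologie galoisienne* II §3.3 Prop. 9)

Topic `NumberTheory/GaloisRepresentations`; namespace `Literature.NumberTheory.GaloisRepresentations`.
Theorems only (no definition, no named fact; D-0026).

Let `F` be a non-archimedean local field of characteristic `0`, `Γ_F = Gal(F̄/F)`, `p` a prime and
`φ : Γ_F → ℤ_p` a continuous homomorphism which is NOT trivial.  Its image is then a non-zero closed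
subgroup of `ℤ_p`, i.e. some `p^s ℤ_p ≅ ℤ_p`, and `ker φ = Gal(F̄/F_∞)` for the `ℤ_p`-extension
`F_∞/F` cut out by `φ`; in particular `p^∞ ∣ [F_∞ : F]`.

* `groupCdLE_one_ker_of_apply_ne_one` — **`cd_p(ker φ) ≤ 1`**, i.e. `H^q(Gal(F̄/F_∞), M) = 0` for
  all `q ≥ 2` and every discrete `p`-primary torsion `Gal(F̄/F_∞)`-module `M` (Serre II §3.3 Prop. 9:
  "if `p^∞` divides `[L : F]` then `cd_p(G_L) ≤ 1`"; Harari Thm. 8.11 (a); this is the step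
  "`G_{(F_∞)_η}` has `p`-cohomological dimension `1`" of Greenberg, LNM 1716 §4 / §2 Prop. 2.4).

Proof: `ker φ = ⋂ₖ S_k` for the open subgroups `S_k = φ⁻¹(p^k ℤ_p)`; above every open `A ≤ Γ_F`
the image `φ(A)` is non-zero (it has finite index in the non-zero torsion-free group `φ(Γ_F)`:
`exists_pow_mem_of_index_ne_zero`), so `(A ∩ S_k : A ∩ S_{k'})` is a non-trivial `p`-group for `k'`
beyond the valuation of a non-zero value — hence divisible by `p` — and `groupCdLE_one_iInf_of_tower`
(`LocalTowerCdOne`: the `p`-part of the Brauer group dies along the tower) applies.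

## References
* J.-P. Serre, *Cohomologie galoisienne* / *Galois Cohomology* (1997), II §3.3 Prop. 9. [SerreGaloisCohomology1997]
* D. Harari, *Galois Cohomology and Class Field Theory* (2020), Thm. 8.11 (a). [Harari2020]
* R. Greenberg, *Iwasawa theory for elliptic curves*, LNM 1716 (1999), §2 (proof of Prop. 2.4), §4
  (paragraph after Lemma 4.5). [GreenbergLNM1716]
-/

noncomputable section

open CategoryTheory Function
open Field IsNonarchimedeanLocalField ValuativeRel IntermediateField

universe u

namespace Literature.NumberTheory.GaloisRepresentations

open _root_.TopRep _root_.ContRepresentation _root_.ContinuousCohomology DiscreteGaloisModule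
open _root_.Topology _root_.Filter

section Padic

variable {p : ℕ} [Fact p.Prime]

/-- An element of `ℤ_p` divisible by every power of `p` is `0` (its norm is below every `p^{-k}`).
[folklore] -/
private theorem padicInt_eq_zero_of_forall_pow_dvd' {x : ℤ_[p]} (h : ∀ k : ℕ, (p : ℤ_[p]) ^ k ∣ x) :
    x = 0 := by
  by_contra hx
  have hpos : 0 < ‖x‖ := norm_pos_iff.2 hx
  obtain ⟨k, hk⟩ := PadicInt.exists_pow_neg_lt p hpos
  have hle : ‖x‖ ≤ (p : ℝ) ^ (-(k : ℤ)) :=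
    (PadicInt.norm_le_pow_iff_mem_span_pow x k).2 (Ideal.mem_span_singleton.2 (h k))
  exact lt_irrefl _ (hk.trans_le hle)

/-- `p^k ∣ x` in `ℤ_p` for `x ≠ 0` iff `k ≤ v_p(x)`. [folklore] -/
private theorem pow_dvd_iff_le_valuation' {x : ℤ_[p]} (hx : x ≠ 0) (k : ℕ) :
    (p : ℤ_[p]) ^ k ∣ x ↔ k ≤ x.valuation := by
  rw [← Ideal.mem_span_singleton]
  exact PadicInt.mem_span_pow_iff_le_valuation x hx k

end Padic

section Local

variable (F : Type u) [Field F] [ValuativeRel F] [TopologicalSpace F] [IsNonarchimedeanLocalField F]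
  [CharZero F] {p : ℕ} [hp : Fact p.Prime]
  (φ : absoluteGaloisGroup F →ₜ* Multiplicative ℤ_[p])

/-! ### The tower `S_k = φ⁻¹(p^k ℤ_p)` -/

omit [ValuativeRel F] [TopologicalSpace F] [IsNonarchimedeanLocalField F] [CharZero F] in
/-- Membership in `S_k = φ⁻¹(p^k ℤ_p)`: `σ ∈ S_k ↔ p^k ∣ φ σ`. [folklore] -/
private theorem mem_tower_iff (k : ℕ) (σ : absoluteGaloisGroup F) :
    σ ∈ (AddSubgroup.toSubgroup (Ideal.span {(p : ℤ_[p]) ^ k}).toAddSubgroup).comap φ.toMonoidHom ↔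
      (p : ℤ_[p]) ^ k ∣ (φ σ).toAdd := by
  rw [Subgroup.mem_comap, Multiplicative.mem_toSubgroup, Submodule.mem_toAddSubgroup,
    Ideal.mem_span_singleton]
  rfl

omit [ValuativeRel F] [TopologicalSpace F] [IsNonarchimedeanLocalField F] [CharZero F] in
/-- The tower `S_k = φ⁻¹(p^k ℤ_p)` decreases. [folklore] -/
private theorem tower_antitone :
    Antitone fun k : ℕ =>
      (AddSubgroup.toSubgroup (Ideal.span {(p : ℤ_[p]) ^ k}).toAddSubgroup).comap φ.toMonoidHom := by
  intro k k' hkk' σ hσ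
  rw [mem_tower_iff] at hσ ⊢
  exact (pow_dvd_pow _ hkk').trans hσ

omit [ValuativeRel F] [TopologicalSpace F] [IsNonarchimedeanLocalField F] [CharZero F] in
/-- `S_k = φ⁻¹(p^k ℤ_p)` is open: `p^k ℤ_p = {‖x‖ ≤ p^{-k}}` is a closed ball of positive radius in an
ultrametric space. [folklore] -/
private theorem isOpen_tower (k : ℕ) :
    IsOpen (((AddSubgroup.toSubgroup (Ideal.span {(p : ℤ_[p]) ^ k}).toAddSubgroup).comap φ.toMonoidHom :
      Subgroup (absoluteGaloisGroup F)) : Set (absoluteGaloisGroup F)) := by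
  have hball : ((Ideal.span {(p : ℤ_[p]) ^ k} : Ideal ℤ_[p]) : Set ℤ_[p]) =
      Metric.closedBall (0 : ℤ_[p]) ((p : ℝ) ^ (-k : ℤ)) := by
    ext x
    rw [SetLike.mem_coe, Metric.mem_closedBall, dist_zero_right, PadicInt.norm_le_pow_iff_mem_span_pow]
  have hopen : IsOpen ((Ideal.span {(p : ℤ_[p]) ^ k} : Ideal ℤ_[p]) : Set ℤ_[p]) := by
    rw [hball]
    refine IsUltrametricDist.isOpen_closedBall _ (zpow_ne_zero _ ?_)
    exact_mod_cast hp.out.ne_zero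
  exact hopen.preimage (map_continuous φ)

omit [ValuativeRel F] [TopologicalSpace F] [IsNonarchimedeanLocalField F] [CharZero F] in
/-- `⋂ₖ φ⁻¹(p^k ℤ_p) = ker φ`. [folklore] -/
private theorem iInf_tower_eq_ker :
    (⨅ k : ℕ, (AddSubgroup.toSubgroup (Ideal.span {(p : ℤ_[p]) ^ k}).toAddSubgroup).comap φ.toMonoidHom) =
      φ.toMonoidHom.ker := by
  ext σ
  rw [Subgroup.mem_iInf, MonoidHom.mem_ker]
  simp_rw [mem_tower_iff]
  constructor
  · intro h
    have h0 : (φ σ).toAdd = 0 := padicInt_eq_zero_of_forall_pow_dvd' h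
    change φ σ = 1
    rw [← ofAdd_toAdd (φ σ), h0, ofAdd_zero]
  · intro h k
    have h1 : φ σ = 1 := h
    rw [h1, toAdd_one]
    exact dvd_zero _

omit [ValuativeRel F] [TopologicalSpace F] [IsNonarchimedeanLocalField F] [CharZero F] in
/-- Powers: `φ(σ^m) = m · φ(σ)` in `ℤ_p`. [folklore] -/
private theorem toAdd_apply_pow (σ : absoluteGaloisGroup F) (m : ℕ) :
    (φ (σ ^ m)).toAdd = (m : ℤ_[p]) * (φ σ).toAdd := by
  rw [map_pow, toAdd_pow, nsmul_eq_mul]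

/-! ### Above every open subgroup the `p`-part of the index grows -/

omit [ValuativeRel F] [TopologicalSpace F] [IsNonarchimedeanLocalField F] [CharZero F] in
/-- **A non-trivial `φ` is non-trivial on every open subgroup `A`**: some power `σ^n ∈ A`
(`0 < n ≤ (Γ_F : A)`, `exists_pow_mem_of_index_ne_zero`) of a `σ` with `φ σ ≠ 0`, and
`φ(σ^n) = n φ(σ) ≠ 0` in the torsion-free group `ℤ_p`. [folklore] -/
private theorem exists_mem_toAdd_apply_ne_zero (hφ : ∃ σ, φ σ ≠ 1) (A : Subgroup (absoluteGaloisGroup F))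
    (hA : IsOpen (A : Set (absoluteGaloisGroup F))) : ∃ τ ∈ A, (φ τ).toAdd ≠ 0 := by
  haveI := absoluteGaloisGroup_compactSpace F
  obtain ⟨σ, hσ⟩ := hφ
  have hidx : A.index ≠ 0 := by
    haveI : Finite (absoluteGaloisGroup F ⧸ A) := Subgroup.quotient_finite_of_isOpen A hA
    rw [Subgroup.index_eq_card]
    exact Nat.card_pos.ne'
  obtain ⟨n, hn0, -, hnA⟩ := Subgroup.exists_pow_mem_of_index_ne_zero hidx σ
  refine ⟨σ ^ n, hnA, ?_⟩
  rw [toAdd_apply_pow]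
  have hσ' : (φ σ).toAdd ≠ 0 := fun h => hσ (by rw [← ofAdd_toAdd (φ σ), h, ofAdd_zero])
  exact mul_ne_zero (Nat.cast_ne_zero.2 hn0.ne') hσ'

omit [ValuativeRel F] [TopologicalSpace F] [IsNonarchimedeanLocalField F] [CharZero F] in
/-- **`p ∣ (A ∩ S_k : A ∩ S_{k'})` for `k'` large**, for every open `A ≤ Γ_F` and every `k`, when `φ`
is non-trivial: with `τ ∈ A`, `φ τ ≠ 0` of valuation `s`, and `k' = max k s + 1`, the quotient
`(A ∩ S_k)/(A ∩ S_{k'})` is a `p`-group (`σ^{p^{k'-k}} ∈ S_{k'}` for `σ ∈ S_k`) containing the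
non-trivial class of `τ^{p^{max k s - s}}` (valuation `max k s ∈ [k, k')`). [folklore] -/
private theorem exists_dvd_relIndex_tower (hφ : ∃ σ, φ σ ≠ 1) (A : Subgroup (absoluteGaloisGroup F))
    (hA : IsOpen (A : Set (absoluteGaloisGroup F))) (k : ℕ) :
    ∃ k', k ≤ k' ∧ p ∣
      (A ⊓ (AddSubgroup.toSubgroup (Ideal.span {(p : ℤ_[p]) ^ k'}).toAddSubgroup).comap φ.toMonoidHom).relIndex
        (A ⊓ (AddSubgroup.toSubgroup (Ideal.span {(p : ℤ_[p]) ^ k}).toAddSubgroup).comap φ.toMonoidHom) := by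
  classical
  set S : ℕ → Subgroup (absoluteGaloisGroup F) := fun j =>
    (AddSubgroup.toSubgroup (Ideal.span {(p : ℤ_[p]) ^ j}).toAddSubgroup).comap φ.toMonoidHom with hSdef
  obtain ⟨τ, hτA, hτ⟩ := exists_mem_toAdd_apply_ne_zero F φ hφ A hA
  set s : ℕ := ((φ τ).toAdd).valuation with hsdef
  set k' : ℕ := max k s + 1 with hk'def
  refine ⟨k', (le_max_left k s).trans (Nat.le_succ _), ?_⟩
  change p ∣ (A ⊓ S k').relIndex (A ⊓ S k)
  set H : Subgroup (absoluteGaloisGroup F) := A ⊓ S k with hHdef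
  -- `S_{k'}` is normal (abelian target) and `A ∩ S_{k'} = S_{k'} ∩ (A ∩ S_k)`
  haveI hSn : (S k').Normal := by
    rw [hSdef]
    exact Subgroup.Normal.comap inferInstance _
  have hkk' : k ≤ k' := (le_max_left k s).trans (Nat.le_succ _)
  have hinf : A ⊓ S k' = S k' ⊓ H := by
    rw [hHdef, inf_comm (S k'), inf_assoc, inf_eq_right.2 (tower_antitone F φ hkk')]
  rw [hinf, Subgroup.inf_relIndex_right, Subgroup.relIndex]
  -- the quotient `H / (S_{k'} ∩ H)` is a `p`-group
  haveI : ((S k').subgroupOf H).Normal := inferInstance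
  have hP : IsPGroup p (H ⧸ (S k').subgroupOf H) := by
    intro x
    obtain ⟨h, rfl⟩ := QuotientGroup.mk_surjective x
    refine ⟨k' - k, ?_⟩
    rw [← QuotientGroup.mk_pow, QuotientGroup.eq_one_iff, Subgroup.mem_subgroupOf, Subgroup.coe_pow]
    have hk : (h : absoluteGaloisGroup F) ∈ S k := (Subgroup.mem_inf.1 h.2).2
    rw [hSdef, mem_tower_iff] at hk ⊢
    rw [toAdd_apply_pow, Nat.cast_pow]
    obtain ⟨c, hc⟩ := hk
    rw [hc, ← mul_assoc, ← pow_add, Nat.sub_add_cancel hkk']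
    exact dvd_mul_right _ _
  rw [Subgroup.index_eq_card]
  rcases hP.card_eq_or_dvd with h1 | hdvd
  · -- the quotient is non-trivial: `τ^{p^m}`, `m = max k s - s`, lies in `H \ S_{k'}`
    exfalso
    set m : ℕ := max k s - s with hmdef
    have hms : m + s = max k s := by rw [hmdef, Nat.sub_add_cancel (le_max_right k s)]
    have hval : ((φ (τ ^ p ^ m)).toAdd).valuation = max k s := by
      rw [toAdd_apply_pow, Nat.cast_pow, PadicInt.valuation_p_pow_mul _ _ hτ, ← hsdef, hms]
    have hne : (φ (τ ^ p ^ m)).toAdd ≠ 0 := by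
      rw [toAdd_apply_pow, Nat.cast_pow]
      exact mul_ne_zero (pow_ne_zero _ (Nat.cast_ne_zero.2 hp.out.ne_zero)) hτ
    have hmemH : τ ^ p ^ m ∈ H := by
      refine Subgroup.mem_inf.2 ⟨A.pow_mem hτA _, ?_⟩
      rw [hSdef, mem_tower_iff, pow_dvd_iff_le_valuation' hne, hval]
      exact le_max_left k s
    have hnot : τ ^ p ^ m ∉ S k' := by
      rw [hSdef, mem_tower_iff, pow_dvd_iff_le_valuation' hne, hval, hk'def]
      omega
    have htop : (S k').subgroupOf H = ⊤ := by
      rw [← Subgroup.index_eq_one, Subgroup.index_eq_card]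
      exact h1
    have : (⟨τ ^ p ^ m, hmemH⟩ : H) ∈ (S k').subgroupOf H := by rw [htop]; exact Subgroup.mem_top _
    exact hnot (Subgroup.mem_subgroupOf.1 this)
  · exact hdvd

/-! ### `cd_p(ker φ) ≤ 1` -/

/-- **`cd_p(Gal(F̄/F_∞)) ≤ 1` for the `ℤ_p`-tower `F_∞/F` of a non-archimedean local field `F` of
characteristic `0`**: for a continuous NON-TRIVIAL homomorphism `φ : Γ_F → ℤ_p` (written
multiplicatively), `cd_p(ker φ) ≤ 1`.  Serre, *Cohomologie galoisienne* II §3.3 Prop. 9 ("si `p^∞`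
divise `[L : F]`, alors `cd_p(G_L) ≤ 1`") / Harari Thm. 8.11 (a), in the case `L = F_∞`; this is the
step "`G_{(F_∞)_η}` has `p`-cohomological dimension `1`" of Greenberg, LNM 1716, §2 (proof of
Prop. 2.4) and §4 (after Lemma 4.5).  Proof: `ker φ = ⋂ₖ φ⁻¹(p^k ℤ_p)` (`iInf_tower_eq_ker`) and
`groupCdLE_one_iInf_of_tower` (`LocalTowerCdOne`) with `exists_dvd_relIndex_tower`.
[cite: SerreGaloisCohomology1997, II §3.3 Prop. 9] [cite: Harari2020, Thm. 8.11 (a)]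
[cite: GreenbergLNM1716, §2 (proof of Prop. 2.4), §4 (after Lemma 4.5)] -/
theorem groupCdLE_one_ker_of_apply_ne_one (hφ : ∃ σ, φ σ ≠ 1) :
    GroupCdLE φ.toMonoidHom.ker p 1 := by
  rw [← iInf_tower_eq_ker F φ]
  exact groupCdLE_one_iInf_of_tower F p _ (tower_antitone F φ) (isOpen_tower F φ)
    (fun A hA k => exists_dvd_relIndex_tower F φ hφ A hA k)

end Local

end Literature.NumberTheory.GaloisRepresentations

end
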